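import Summits.QuantumAdvantage.QuantumAdvantage.Theorems.CubicForrelationNearExactIsExactTwoModSixPrep

/-!
# Crux `CubicForrelation.NearExactIsExact` (stmt-QuantumAdvantage-14043) — `n = 6r + 2` bits, TWO-SIDED: at level `≥ 2r+2`
  (`W_g ∈ 2^{2r+2}ℤ`) the boundary value forces exactness, `Φ ≥ 1 − 2^{−(2r+1)} ⇒ Φ = 1` (general `r ≥ 2`)

Certificate seat `b2b-cforr-cert` (gen 6).  HONEST FRAMING: a theorem, uniform in `r`, about cubic Boolean pairs on `6r+2` bits (the level-`(2r+2)`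
boundary configuration of the uniform one-sided rate; higher levels by the tower); infinitely many finite-slice verdicts, NOT summit progress.

`tml_level_ge`: for cubic `f, g : 𝔽₂^{6r+2} → 𝔽₂` (`r ≥ 2`) with `W_g = 2^{2r+2}·u'` and `Φ(f,g) ≥ 1 − 2^{−(2r+1)}`: `Φ(f,g) = 1`.  Proof (the `n = 20`
argument with `r` symbolic).  If every `u'` is even, `tms_high_levels`.  Otherwise `p = [u' odd]` is quadratic (tower), the budget
`Σ(u − 2^r s)² = 4Σ(u' − 2^{r−1}s)² = 2^{8r+3}(1−Φ) ≤ 2^{6r+2}` (`u = 2u'`) pays `≥ 1` per odd point and `RM(2, 6r+2)` gives `#P ≥ 2^{6r}`: `P`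
is a codimension-2 FLAT `x₁ ⊕ V₀`, `e := u' − 2^{r−1}s = ±1` on `P`, `u' = 2^{r−1}s` off `P`.  Two directions transversal to `V₀` (`fl1_dirs2`); the
general 5- and 6-flat sums (`8 ∣ Σ₅ u`, `16 ∣ Σ₆ u`; Ax `2^rΣ(−1)^f ∈ 2^{r+2}ℤ`) localise (`sp_loc2`) and give (H3)/(H4); the engine `fl1_flat_l1`
yields `(Σ|(e1_P)^|)² ≤ 2^{12r+6}`, while the pairing needs `Σ_y (−1)^g (2e1_P)^(y) = 2^{8r+2}`, i.e. `2^{16r+2} ≤ 2^{12r+6}` — false for `r ≥ 2`.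

References: J. Ax (1964) / R. J. McEliece (1972); MacWilliams–Sloane (1977) Ch. 13–15; X.-D. Hou (1998); R. O'Donnell (2014) §3.3.  Everything
below is proved from Mathlib and the tree; axioms are the standard three.
-/

set_option linter.dupNamespace false -- D-0017: single-problem summit ⇒ `QuantumAdvantage.QuantumAdvantage` by design

noncomputable section

namespace Summit.QuantumAdvantage.QuantumAdvantage.Theorems.CubicForrelation.NearExactIsExact

open Finset
open Literature.Computability.QuantumComplexity
open Literature.Computability.QuantumComplexity.BuzetChailloux (bxor zeroVec bxor_bxor_cancel_left bxor_zeroVec zeroVec_bxor bxor_comm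
  bxor_self)
open Literature.Computability.QuantumComplexity.DerivativeWalsh (W)

/-- **Level `≥ 2r+2` on `6r+2` bits (`r ≥ 2`): `Φ ≥ 1 − 2^{−(2r+1)} ⇒ Φ = 1`.**  For cubic `f, g : 𝔽₂^{(3r+1)+(3r+1)} → 𝔽₂` with
`W_g = 2^{2r+2}·u'` and `Φ(f,g) ≥ 1 − (1/2)^{2r+1}` the pair is exact.  Uniform in `r`; NOT summit progress. [this work] -/
theorem tml_level_ge (r : ℕ) (hr : 2 ≤ r) (f g : (Fin ((3 * r + 1) + (3 * r + 1)) → Bool) → Bool) (hf : IsDegLeFun 3 f)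
    (hg : IsDegLeFun 3 g) (u' : (Fin ((3 * r + 1) + (3 * r + 1)) → Bool) → ℤ)
    (hu' : ∀ x, W (fun y => signOf (g y)) x = (2 : ℝ) ^ (2 * r + 2) * (u' x : ℝ))
    (hΦ : 1 - (1 / 2 : ℝ) ^ (2 * r + 1) ≤ forrelation f g) : forrelation f g = 1 := by
  classical
  -- higher levels
  by_cases hall : ∀ x, ¬ Odd (u' x)
  · have hw := tw_level_up g u' hu' hall
    exact tms_high_levels r hr f g hf hg _ (by simpa only [show 2 * r + 2 + 1 = 2 * r + 3 by ring] using hw) hΦ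
  exfalso
  push Not at hall
  obtain ⟨x₁, hx₁⟩ := hall
  obtain ⟨k, rfl⟩ : ∃ k, r = k + 2 := ⟨r - 2, by omega⟩
  -- `u = 2u'` at the Ax level `2r+1`
  set u : (Fin ((3 * (k + 2) + 1) + (3 * (k + 2) + 1)) → Bool) → ℤ := fun x => 2 * u' x with hudef
  have hu : ∀ x, W (fun y => signOf (g y)) x = (2 : ℝ) ^ (2 * (k + 2) + 1) * (u x : ℝ) := by
    intro x; rw [hu' x]; simp only [u]; push_cast; ring
  -- the parity of `u'` is quadratic
  have hp : IsDegLeFun 2 (fun x => decide (Odd (u' x))) :=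
    stub_walshTower stub_axParity ((3 * (k + 2) + 1) + (3 * (k + 2) + 1)) (2 * (k + 2) + 2) 2 g u' hg hu' (by intro j hj hjn; omega)
  have hp' : IsDegLeFun (1 + 1) (fun x => decide (Odd (u' x))) := hp
  -- budget `Σ (u' − 2^{r−1}s)² ≤ 2^{6r}`
  have hbud := tms_budget (k + 2) f g u hu
  have hpow : (2 : ℝ) ^ (8 * (k + 2) + 3) * (1 / 2) ^ (2 * (k + 2) + 1) = 2 ^ (6 * k + 14) := by
    rw [one_div_pow]; field_simp; ring
  have hTle : (∑ x, (u x - 2 ^ (k + 2) * sZ (f x)) ^ 2 : ℤ) ≤ 2 ^ (6 * k + 14) := by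
    have h1 : 1 - forrelation f g ≤ (1 / 2 : ℝ) ^ (2 * (k + 2) + 1) := by linarith
    have h' : ((∑ x, (u x - 2 ^ (k + 2) * sZ (f x)) ^ 2 : ℤ) : ℝ) ≤ (2 : ℝ) ^ (6 * k + 14) := by
      rw [hbud, ← hpow]
      exact mul_le_mul_of_nonneg_left h1 (by positivity)
    exact_mod_cast h'
  have h4 : ∀ x, (u x - 2 ^ (k + 2) * sZ (f x)) ^ 2 = 4 * (u' x - 2 ^ (k + 1) * sZ (f x)) ^ 2 := fun x => by simp only [u]; ring
  have hB : (∑ x, (u' x - 2 ^ (k + 1) * sZ (f x)) ^ 2 : ℤ) ≤ 2 ^ (6 * k + 12) := by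
    rw [sum_congr rfl fun x _ => h4 x, ← mul_sum] at hTle
    have : (2 : ℤ) ^ (6 * k + 14) = 4 * 2 ^ (6 * k + 12) := by ring
    linarith
  -- RM: `#P ≥ 2^{6r}`
  set P := univ.filter (fun x : Fin ((3 * (k + 2) + 1) + (3 * (k + 2) + 1)) → Bool => Odd (u' x)) with hPdef
  have hmemP : ∀ x, x ∈ P ↔ Odd (u' x) := fun x => by simp [hPdef]
  have hfilt : (univ.filter fun x : Fin ((3 * (k + 2) + 1) + (3 * (k + 2) + 1)) → Bool => decide (Odd (u' x)) = true) = P :=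
    filter_congr fun x _ => by simp
  have hRM := bb_rmWeight_holds ((3 * (k + 2) + 1) + (3 * (k + 2) + 1)) 2 (fun x => decide (Odd (u' x))) hp ⟨x₁, by simpa using hx₁⟩
  rw [hfilt] at hRM
  have hPge : 2 ^ (6 * k + 12) ≤ #P := by
    have h2 : (2 : ℕ) ^ ((3 * (k + 2) + 1) + (3 * (k + 2) + 1)) = 2 ^ 2 * 2 ^ (6 * k + 12) := by ring
    rw [h2] at hRM
    exact Nat.le_of_mul_le_mul_left hRM (by positivity)
  -- everything is tight
  have hsumP : (∑ x, (if Odd (u' x) then 1 else 0 : ℤ)) = #P := by rw [sum_boole]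
  have hnonneg : ∀ x, 0 ≤ (u' x - 2 ^ (k + 1) * sZ (f x)) ^ 2 - (if Odd (u' x) then 1 else 0 : ℤ) := by
    intro x
    by_cases h : Odd (u' x)
    · rw [if_pos h]
      have hodd' : Odd (u' x - 2 ^ (k + 1) * sZ (f x)) := by
        have h2 : Even ((2 : ℤ) ^ (k + 1) * sZ (f x)) := by rw [pow_succ]; exact ⟨2 ^ k * sZ (f x), by ring⟩
        exact Int.odd_sub.2 (iff_of_true h h2)
      have h0 := Int.odd_iff.1 hodd'
      have : u' x - 2 ^ (k + 1) * sZ (f x) ≤ -1 ∨ 1 ≤ u' x - 2 ^ (k + 1) * sZ (f x) := by omega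
      have := tp_sq_ge (k := 1) (by norm_num) this
      linarith
    · rw [if_neg h]; have := sq_nonneg (u' x - 2 ^ (k + 1) * sZ (f x)); linarith
  have hsum0 : ∑ x, ((u' x - 2 ^ (k + 1) * sZ (f x)) ^ 2 - (if Odd (u' x) then 1 else 0 : ℤ)) = 0 := by
    refine le_antisymm ?_ (sum_nonneg fun x _ => hnonneg x)
    rw [sum_sub_distrib, hsumP]
    have : (2 : ℤ) ^ (6 * k + 12) ≤ #P := by exact_mod_cast hPge
    linarith
  have hzero' : ∀ x, (u' x - 2 ^ (k + 1) * sZ (f x)) ^ 2 - (if Odd (u' x) then 1 else 0 : ℤ) = 0 :=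
    fun x => (sum_eq_zero_iff_of_nonneg fun y _ => hnonneg y).1 hsum0 x (mem_univ x)
  have hoff : ∀ x, ¬ Odd (u' x) → u' x - 2 ^ (k + 1) * sZ (f x) = 0 := by
    intro x hx
    have h := hzero' x
    rw [if_neg hx, sub_zero] at h
    exact (pow_eq_zero_iff two_ne_zero).1 h
  have hon : ∀ x, Odd (u' x) → u' x - 2 ^ (k + 1) * sZ (f x) = 1 ∨ u' x - 2 ^ (k + 1) * sZ (f x) = -1 := by
    intro x hx
    have h := hzero' x
    rw [if_pos hx] at h
    have h1 : (u' x - 2 ^ (k + 1) * sZ (f x)) * (u' x - 2 ^ (k + 1) * sZ (f x)) = 1 := by rw [← pow_two]; linarith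
    exact mul_self_eq_one_iff.1 h1
  have hPcard : #P = 2 ^ (6 * k + 12) := by
    have hle : (#P : ℤ) ≤ 2 ^ (6 * k + 12) := by
      rw [← hsumP]
      exact le_trans (sum_le_sum fun x _ => by have := hnonneg x; linarith) hB
    have hle' : #P ≤ 2 ^ (6 * k + 12) := by exact_mod_cast hle
    omega
  have hTeq : (2 : ℝ) ^ (8 * (k + 2) + 3) * (1 - forrelation f g) = 2 ^ (6 * k + 14) := by
    have hT : (∑ x, (u x - 2 ^ (k + 2) * sZ (f x)) ^ 2 : ℤ) = 2 ^ (6 * k + 14) := by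
      have e : ∀ x, (u x - 2 ^ (k + 2) * sZ (f x)) ^ 2 = 4 * ((u' x - 2 ^ (k + 1) * sZ (f x)) ^ 2 - (if Odd (u' x) then 1 else 0 : ℤ)) +
          4 * (if Odd (u' x) then 1 else 0 : ℤ) := fun x => by simp only [u]; ring
      rw [sum_congr rfl fun x _ => e x, sum_add_distrib, ← mul_sum, ← mul_sum, hsum0, hsumP, hPcard]
      push_cast; ring
    have h : ((∑ x, (u x - 2 ^ (k + 2) * sZ (f x)) ^ 2 : ℤ) : ℝ) = 2 ^ (6 * k + 14) := by exact_mod_cast hT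
    rw [hbud] at h
    exact h
  -- `P` is a codimension-2 flat
  have hmw := mw_flat_of_minweight 1 (fun x => decide (Odd (u' x))) hp' (by rw [hfilt, hPcard]; ring)
  rw [hfilt] at hmw
  obtain ⟨h0, hadd, hcardV, hcoset⟩ := hmw
  set V₀ := univ.filter (fun a : Fin ((3 * (k + 2) + 1) + (3 * (k + 2) + 1)) → Bool => ∀ x,
    decide (Odd (u' (bxor x a))) = decide (Odd (u' x))) with hV₀
  have hS : P = V₀.image (bxor x₁) := hcoset x₁ (by simpa using hx₁)
  rw [hPcard] at hcardV
  -- two transversal directions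
  obtain ⟨t₁, -, t₂, -, ht₁, ht₂, -, ht₂₁⟩ := fl1_dirs2 univ V₀ (by
    rw [hcardV, card_univ, Fintype.card_fun, Fintype.card_bool, Fintype.card_fin]
    have e : (2 : ℕ) ^ ((3 * (k + 2) + 1) + (3 * (k + 2) + 1)) = 4 * 2 ^ (6 * k + 12) := by ring
    rw [e]
    have hX : 0 < 2 ^ (6 * k + 12) := Nat.two_pow_pos _
    linarith)
  -- the sign pattern and the vanishing of the residual off `P`
  set e : (Fin ((3 * (k + 2) + 1) + (3 * (k + 2) + 1)) → Bool) → ℤ := fun x => u' x - 2 ^ (k + 1) * sZ (f x) with hedef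
  have he : ∀ x ∈ P, e x = 1 ∨ e x = -1 := fun x hx => hon x ((hmemP x).1 hx)
  have hF0 : ∀ y, y ∉ P → u y - 2 ^ (k + 2) * sZ (f y) = 0 := by
    intro y hy
    have := hoff y (fun h => hy ((hmemP y).2 h))
    simp only [u]
    have e4 : (2 : ℤ) ^ (k + 2) = 2 * 2 ^ (k + 1) := by ring
    rw [e4]; linarith
  have hFe : ∀ y, u y - 2 ^ (k + 2) * sZ (f y) = 2 * e y := fun y => by simp only [u, e]; ring
  have hPV : ∀ x, x ∈ P → ∀ a ∈ V₀, bxor x a ∈ P := fun x hx a ha => fl1_coset_vadd hadd hS hx ha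
  have hz : ∀ p ∈ P, ∀ w, w ∉ V₀ → u (bxor p w) - 2 ^ (k + 2) * sZ (f (bxor p w)) = 0 :=
    fun p hp w hw => hF0 _ (fl1_coset_out h0 hadd hS hp hw)
  -- localisation by the two directions
  have hloc : ∀ {kk : ℕ} (x : Fin ((3 * (k + 2) + 1) + (3 * (k + 2) + 1)) → Bool) (a : Fin kk → Fin ((3 * (k + 2) + 1) + (3 * (k + 2) + 1)) → Bool),
      (∀ ε : Fin kk → Bool, (fun j => x j ^^ decide (Odd #(univ.filter fun i => ε i && a i j))) ∈ P) →
      ∑ ε : Fin (kk + 2) → Bool, (u (fun j => x j ^^ decide (Odd #(univ.filter fun i =>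
          ε i && (Matrix.vecCons t₁ (Matrix.vecCons t₂ a) : Fin (kk + 2) → Fin ((3 * (k + 2) + 1) + (3 * (k + 2) + 1)) → Bool) i j))) -
        2 ^ (k + 2) * sZ (f (fun j => x j ^^ decide (Odd #(univ.filter fun i =>
          ε i && (Matrix.vecCons t₁ (Matrix.vecCons t₂ a) : Fin (kk + 2) → Fin ((3 * (k + 2) + 1) + (3 * (k + 2) + 1)) → Bool) i j))))) =
      ∑ ε : Fin kk → Bool, 2 * e (fun j => x j ^^ decide (Odd #(univ.filter fun i => ε i && a i j))) := by
    intro kk x a hin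
    have key := sp_loc2 (fun y => u y - 2 ^ (k + 2) * sZ (f y)) x t₁ t₂ a (fun ε => hz _ (hin ε) t₁ ht₁)
      (fun ε => hz _ (hin ε) t₂ ht₂) (fun ε => by rw [iw_bxor_assoc]; exact hz _ (hin ε) _ ht₂₁)
    beta_reduce at key
    rw [key]
    exact sum_congr rfl fun ε _ => hFe _
  -- (H3) and (H4)
  have H3 : ∀ x ∈ P, ∀ a b c : Fin ((3 * (k + 2) + 1) + (3 * (k + 2) + 1)) → Bool, a ∈ V₀ → b ∈ V₀ → c ∈ V₀ →
      (4 : ℤ) ∣ ∑ ε : Fin 3 → Bool, e (fun j => x j ^^ decide (Odd #(univ.filter fun i =>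
        ε i && (![a, b, c] : Fin 3 → Fin ((3 * (k + 2) + 1) + (3 * (k + 2) + 1)) → Bool) i j))) := by
    intro x hx a b c ha hb hc
    have hin : ∀ ε : Fin 3 → Bool, (fun j => x j ^^ decide (Odd #(univ.filter fun i =>
        ε i && (![a, b, c] : Fin 3 → Fin ((3 * (k + 2) + 1) + (3 * (k + 2) + 1)) → Bool) i j))) ∈ P :=
      fun ε => fr_mem_flatPt3 V₀ h0 (· ∈ P) hPV hx ![a, b, c] (fun i => by fin_cases i <;> assumption) ε
    have h8 := fs_flat_sum_dvd (e := 3) g u hg hu x ![t₁, t₂, a, b, c] (by omega)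
    obtain ⟨zf, hzf⟩ := sl_sum_sZ_flat f hf x ![t₁, t₂, a, b, c]
    have hzf' : ∑ ε : Fin 5 → Bool, 2 ^ (k + 2) * sZ (f (fun j => x j ^^ decide (Odd #(univ.filter fun i =>
          ε i && (![t₁, t₂, a, b, c] : Fin 5 → Fin ((3 * (k + 2) + 1) + (3 * (k + 2) + 1)) → Bool) i j)))) = 8 * (2 ^ (k + 1) * zf) := by
      rw [← mul_sum, hzf]; norm_num; ring
    have h8n : (8 : ℤ) ∣ ∑ ε : Fin 5 → Bool, u (fun j => x j ^^ decide (Odd #(univ.filter fun i =>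
          ε i && (![t₁, t₂, a, b, c] : Fin 5 → Fin ((3 * (k + 2) + 1) + (3 * (k + 2) + 1)) → Bool) i j))) := by
      have e8 : (2 : ℤ) ^ 3 = 8 := by norm_num
      rw [e8] at h8; exact h8
    have h8' : (8 : ℤ) ∣ ∑ ε : Fin 5 → Bool, (u (fun j => x j ^^ decide (Odd #(univ.filter fun i =>
          ε i && (![t₁, t₂, a, b, c] : Fin 5 → Fin ((3 * (k + 2) + 1) + (3 * (k + 2) + 1)) → Bool) i j))) -
        2 ^ (k + 2) * sZ (f (fun j => x j ^^ decide (Odd #(univ.filter fun i =>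
          ε i && (![t₁, t₂, a, b, c] : Fin 5 → Fin ((3 * (k + 2) + 1) + (3 * (k + 2) + 1)) → Bool) i j))))) := by
      rw [sum_sub_distrib, hzf']
      exact dvd_sub h8n (Dvd.intro _ rfl)
    rw [hloc x ![a, b, c] hin, ← mul_sum] at h8'
    obtain ⟨k8, hk8⟩ := h8'
    exact ⟨k8, by linarith⟩
  have H4 : ∀ x ∈ P, ∀ a₀ a₁ a₂ a₃ : Fin ((3 * (k + 2) + 1) + (3 * (k + 2) + 1)) → Bool, a₀ ∈ V₀ → a₁ ∈ V₀ → a₂ ∈ V₀ → a₃ ∈ V₀ →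
      (8 : ℤ) ∣ ∑ ε : Fin 4 → Bool, e (fun j => x j ^^ decide (Odd #(univ.filter fun i =>
        ε i && (![a₀, a₁, a₂, a₃] : Fin 4 → Fin ((3 * (k + 2) + 1) + (3 * (k + 2) + 1)) → Bool) i j))) := by
    intro x hx a₀ a₁ a₂ a₃ ha₀ ha₁ ha₂ ha₃
    have hin : ∀ ε : Fin 4 → Bool, (fun j => x j ^^ decide (Odd #(univ.filter fun i =>
        ε i && (![a₀, a₁, a₂, a₃] : Fin 4 → Fin ((3 * (k + 2) + 1) + (3 * (k + 2) + 1)) → Bool) i j))) ∈ P :=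
      fun ε => fr_mem_flatPt4 V₀ h0 (· ∈ P) hPV hx ![a₀, a₁, a₂, a₃] (fun i => by fin_cases i <;> assumption) ε
    have h16 := fs_flat_sum_dvd (e := 4) g u hg hu x ![t₁, t₂, a₀, a₁, a₂, a₃] (by omega)
    obtain ⟨zf, hzf⟩ := sl_sum_sZ_flat f hf x ![t₁, t₂, a₀, a₁, a₂, a₃]
    have hzf' : ∑ ε : Fin 6 → Bool, 2 ^ (k + 2) * sZ (f (fun j => x j ^^ decide (Odd #(univ.filter fun i =>
          ε i && (![t₁, t₂, a₀, a₁, a₂, a₃] : Fin 6 → Fin ((3 * (k + 2) + 1) + (3 * (k + 2) + 1)) → Bool) i j)))) = 16 * (2 ^ k * zf) := by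
      rw [← mul_sum, hzf]; norm_num; ring
    have h16n : (16 : ℤ) ∣ ∑ ε : Fin 6 → Bool, u (fun j => x j ^^ decide (Odd #(univ.filter fun i =>
          ε i && (![t₁, t₂, a₀, a₁, a₂, a₃] : Fin 6 → Fin ((3 * (k + 2) + 1) + (3 * (k + 2) + 1)) → Bool) i j))) := by
      have e16 : (2 : ℤ) ^ 4 = 16 := by norm_num
      rw [e16] at h16; exact h16
    have h16' : (16 : ℤ) ∣ ∑ ε : Fin 6 → Bool, (u (fun j => x j ^^ decide (Odd #(univ.filter fun i =>
          ε i && (![t₁, t₂, a₀, a₁, a₂, a₃] : Fin 6 → Fin ((3 * (k + 2) + 1) + (3 * (k + 2) + 1)) → Bool) i j))) -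
        2 ^ (k + 2) * sZ (f (fun j => x j ^^ decide (Odd #(univ.filter fun i =>
          ε i && (![t₁, t₂, a₀, a₁, a₂, a₃] : Fin 6 → Fin ((3 * (k + 2) + 1) + (3 * (k + 2) + 1)) → Bool) i j))))) := by
      rw [sum_sub_distrib, hzf']
      exact dvd_sub h16n (Dvd.intro _ rfl)
    rw [hloc x ![a₀, a₁, a₂, a₃] hin, ← mul_sum] at h16'
    obtain ⟨k16, hk16⟩ := h16'
    exact ⟨k16, by linarith⟩
  -- the engine and the pairing
  have hE := fl1_flat_l1 V₀ P x₁ h0 hadd hS e he H3 H4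
  set A : (Fin ((3 * (k + 2) + 1) + (3 * (k + 2) + 1)) → Bool) → ℝ := fun x => if x ∈ P then (e x : ℝ) else 0 with hA
  have hAτ : (fun x => (u x : ℝ) - (2 : ℝ) ^ (k + 2) * signOf (f x)) = fun x => 2 * A x := by
    funext x
    have h2 : (u x : ℝ) - (2 : ℝ) ^ (k + 2) * signOf (f x) = (((u x - 2 ^ (k + 2) * sZ (f x) : ℤ)) : ℝ) := by
      push_cast; rw [tp_sZ_cast]
    rw [h2]
    by_cases hx : x ∈ P
    · simp only [A, if_pos hx]; rw [hFe x]; push_cast; ring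
    · simp only [A, if_neg hx]; rw [hF0 x hx]; norm_num
  have hpair := tms_pairing (k + 2) f g u hu
  rw [hAτ] at hpair
  have hP : ∑ y, signOf (g y) * W A y = (2 : ℝ) ^ (8 * k + 17) := by
    have e2 : ∀ y, signOf (g y) * W (fun x => 2 * A x) y = 2 * (signOf (g y) * W A y) := fun y => by
      rw [fl1_W_smul]; ring
    rw [sum_congr rfl fun y _ => e2 y, ← mul_sum,
      show (2 : ℝ) ^ (10 * (k + 2) + 3) = 2 ^ (2 * k + 4) * 2 ^ (8 * (k + 2) + 3) by ring, mul_assoc, hTeq] at hpair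
    have e3 : (2 : ℝ) ^ (2 * k + 4) * 2 ^ (6 * k + 14) = 2 * 2 ^ (8 * k + 17) := by ring
    rw [e3] at hpair
    linarith
  have hge' : (2 : ℝ) ^ (8 * k + 17) ≤ ∑ y, |W A y| := by rw [← hP]; exact fl1_pairing_le_l1 g (W A)
  have hsq : ((2 : ℝ) ^ (8 * k + 17)) ^ 2 ≤ (∑ y, |W A y|) ^ 2 := pow_le_pow_left₀ (by positivity) hge' 2
  have hEn : (∑ y, |W A y|) ^ 2 ≤ (2 : ℝ) ^ (12 * k + 30) := by
    refine hE.trans (le_of_eq ?_)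
    rw [show ((3 * (k + 2) + 1) + (3 * (k + 2) + 1)) = 6 * k + 14 by ring]
    ring
  have hbig : (2 : ℝ) ^ (12 * k + 30) < ((2 : ℝ) ^ (8 * k + 17)) ^ 2 := by
    have e2 : ((2 : ℝ) ^ (8 * k + 17)) ^ 2 = 2 ^ (12 * k + 30) * 2 ^ (4 * k + 4) := by ring
    rw [e2]
    have h1 : (1 : ℝ) < 2 ^ (4 * k + 4) := one_lt_pow₀ (by norm_num) (by omega)
    have h2 : (0 : ℝ) < 2 ^ (12 * k + 30) := by positivity
    exact lt_mul_of_one_lt_right h2 h1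
  linarith

end Summit.QuantumAdvantage.QuantumAdvantage.Theorems.CubicForrelation.NearExactIsExact

end
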